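import Literature.MathematicalPhysics.QuantumFieldTheory.Balaban1983to89.Node00.LinearisedAveragingFlat
import Summits.QuantumFields.YangMills.Theorems.BalabanUVNodesK0Stub1RecordAveragingRightInverse
import Summits.QuantumFields.YangMills.Theorems.UnitScaleTiltProp7LinAvgOnto

/-!
# BalabanUVNodes ∕ N07 — PHASE EQUIVARIANCE OF THE (0.4) AVERAGING OF RECORD AND THE U(1) DIRECTIONS OF `Q_k(U₀)`: the matrix extension `avgM ∕ iterM` commutes with central
# phase twists `b ↦ e^{iτθ_b}·V_b` up to the FLAT scalar average of `θ`; hence the trace line of print's `Q_k(U₀)` at EVERY guarded background is the flat one, and the flat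
# scalar line is onto — the U(1) half of def-Y's displayed letter `hQ : Function.Surjective (Node00.QOfRecord F N k U₀)` (✓p814239; custodian remark I.23221 «trace INCLUDED»)

Track A of `YM-PLAN.md` (cell `pub-ymgap`, HUMAN RULING D-0062), DAG node **N07** = [Balaban1985Variational].  Seat `pub-ymgap-dag-n07-e` (g38), CLAIM-2 part (B); sibling of part (A)
`Thm/BalabanUVNodesN07AveragingSubmersionSmallField` (the `𝔰𝔲(N)` directions, from the exact corrector).  `--kind proof --supports stmt-QuantumFields-27238 --as helper` (K0ᴬ);
count-neutral.  THEOREMS ONLY (0 `def`; the scalar average `A` is written out in the statements, never named).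

THE MATHEMATICS (elementary; no estimate of Bałaban's).  Twist a fine matrix field by central phases, `V ↦ (b ↦ e^{iτθ_b}·V_b)` with `θ` REAL.  Along an oriented walk the phases
multiply to `e^{iτθ(Γ)}`, `θ(Γ)` the signed sum (backward steps conjugate the phase: `(e^{ia}V)⋆ = e^{−ia}V⋆`) — §1 `holM_phase`.  In the (0.4) correction factor
`exp[|I|⁻¹ Σ_i log W_i]` a central phase passes through the series logarithm, `log(e^{z}W) = z·1 + log W` for `‖W − 1‖ ≤ 1∕3`, `|z| ≤ 1∕8` (§1 `mlog_exp_smul`: everything commutes,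
`‖z·1 + log W‖ ≤ 5∕8 < ln 2`), so `eml(e^{z_i}W_i) = e^{mean z}·eml W` (§1 `eml_exp_smul`).  Hence (§2 `avgM_phase`) `avgM(e^{iτθ}V)(c) = e^{iτ(Aθ)(c)}·avgM V(c)` with
`(Aθ)(c) = |I|⁻¹Σ_i θ(loop_i(c)) + θ([c₋, c₊])` — the flat linearised average (124) of the scalar field `θ`, NOT depending on `V`; iterating (§2 `iterM_phase_eventually`, for `τ`
near `0` so that the phases stay below `1∕8`) `iterM k(e^{iτθ}V) = e^{iτA^kθ}·iterM k V` with ONE exponent field for all guarded `V`.  Differentiating at `τ = 0` (§3, chain rule +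
uniqueness) at `V = ↑U₀` and at `V = 1`: ★★★ `dIterL_phase_eq_flat_mul` — `Q_k(U₀)(iθ·U₀) = (Q_k(1)(iθ·1))·Ū^k(U₀)`.  Finally (§4) the flat scalar line is ONTO for `k ≤ m + K`:
`∀ ψ ∃ θ, Q_k(1)(iθ·1) = iψ·1` (UST's `linAvg_surjective` projected to the imaginary scalar line by the real-linear `X ↦ (i Im tr X∕N)·1`, which commutes with `linAvg`; induction along
n07-w1's flat chain rule).  CONSUMED BY NAME: 35b `AveragingSmooth` (`stepM ∕ holM ∕ loopM ∕ axialM ∕ corrM ∕ avgM ∕ iterM`, `SmallBelow`, `coeField_iter_eq_iterM`,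
`norm_loopM_coeField_sub_one_lt`), n07-w1 `LinearisedAveragingAtBackground` ∕ `LinearisedAveragingFlat` (`dIterL`, `hasFDerivAt_iterM(_one)`, `dIterL_one_succ`, `dAvgL_one_apply_of_skew`,
`holM_one`, `iterM_apply_one`), UST `BlockAveragingEMLLinearised` (`walkSum`, `linAvg`) ∕ `Prop7LinAvgOnto.linAvg_surjective`, k0-s1 `K0Stub1RecordAveragingRightInverse.linAvg_realLinear`,
`MatrixLog` ∕ `B7BlockAvgLog` (`exp_mlog`, `mlog_exp`, `norm_mlog_le_div`), `ExpMeanLog.eml_eq_exp`.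

HONEST FRAMING: count-neutral helper; elementary calculus ∕ algebra about the tree's own averaging map; nothing of [Balaban1985Averaging] Sect. E or [Balaban1985BackgroundPropagators]
asserted; `hQ` NOT discharged by this file alone (assembly with part (A) and the plumbing = part (C)); `hpos` untouched; P0 OPEN; K0ᴬ∕K1ᴬ∕K3ᴬ OPEN; N07 NOT discharged; COUNT 8∕27
(A 8∕28) · K 1∕4 UNMOVED; one finite 𝕋⁴ programme at fixed `ε` — NOT continuum ∕ ℝ⁴ ∕ OS ∕ mass gap ∕ Clay.  No `sorry`, no `def`, no `instance`, no `notation`; standard axioms.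
-/

noncomputable section

open scoped Matrix.Norms.L2Operator Topology BigOperators
open Filter Asymptotics Function NormedSpace

namespace Summit.QuantumFields.YangMills.BalabanUVNodes.N07AveragingPhaseEquivariance

open Literature.MathematicalPhysics.QuantumFieldTheory.Balaban1983to89
open Literature.MathematicalPhysics.QuantumFieldTheory.Balaban1983to89.T4Continuum
open Literature.MathematicalPhysics.QuantumFieldTheory.Balaban1983to89.BlockAveraging
open Literature.MathematicalPhysics.QuantumFieldTheory.Balaban1983to89.BlockAveragingEMLLinearised (walkSum walkSum_cons linAvg)
open Literature.MathematicalPhysics.QuantumFieldTheory.Balaban1983to89.ExpMeanLog (eml eml_eq_exp expMeanLogSU deltaSU lt_third_of_lt_deltaSU)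
open MatrixLog (mlog exp_mlog norm_mlog_le_div)
open B7BlockAvgLog (mlog_exp)
open Literature.MathematicalPhysics.QuantumFieldTheory.Balaban1983to89.Node00

/-! ## §1  Central phases through `log`, `eml` and walk products -/

section Central

variable {N : ℕ} [NeZero N]

omit [NeZero N] in
/-- `exp (z·1) = e^z·1` in the matrix algebra (`algebraMap_exp_comm`). [folklore] -/
theorem exp_smul_one_eq (z : ℂ) : exp (z • (1 : Matrix (Fin N) (Fin N) ℂ)) = Complex.exp z • (1 : Matrix (Fin N) (Fin N) ℂ) := by
  rw [← Algebra.algebraMap_eq_smul_one, ← algebraMap_exp_comm z, Algebra.algebraMap_eq_smul_one, Complex.exp_eq_exp_ℂ]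

/-- **THE SERIES LOGARITHM OF A CENTRAL PHASE TIMES A NEAR-IDENTITY MATRIX**: for `‖z‖ ≤ 1∕8` and `‖W − 1‖ ≤ 1∕3`, `log(e^z·W) = z·1 + log W` (`e^z·W = exp(z·1 + log W)` by
`exp_mlog` and commutation of the central term; `‖z·1 + log W‖ ≤ 1∕8 + 1∕2 < ln 2` by `norm_mlog_le_div`, so `mlog_exp` applies). [cite: Balaban1985Averaging, (21) p.21, (26) p.22] -/
theorem mlog_exp_smul {z : ℂ} (hz : ‖z‖ ≤ 1 / 8) {W : Matrix (Fin N) (Fin N) ℂ} (hW : ‖W - 1‖ ≤ 1 / 3) :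
    mlog (Complex.exp z • W) = z • (1 : Matrix (Fin N) (Fin N) ℂ) + mlog W := by
  have hW1 : ‖W - 1‖ < 1 := hW.trans_lt (by norm_num)
  have hlogW : ‖mlog W‖ ≤ 1 / 2 := by
    refine (norm_mlog_le_div hW1).trans ?_
    rw [div_le_iff₀ (by linarith)]
    linarith
  letI : NormedAlgebra ℚ (Matrix (Fin N) (Fin N) ℂ) := NormedAlgebra.restrictScalars ℚ ℂ _
  have hcomm : Commute (z • (1 : Matrix (Fin N) (Fin N) ℂ)) (mlog W) := ((Commute.one_left (mlog W)).smul_left z)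
  have hprod : Complex.exp z • W = exp (z • (1 : Matrix (Fin N) (Fin N) ℂ) + mlog W) := by
    rw [exp_add_of_commute hcomm, exp_smul_one_eq, exp_mlog hW1, smul_mul_assoc, one_mul]
  have hsmall : ‖z • (1 : Matrix (Fin N) (Fin N) ℂ) + mlog W‖ < Real.log 2 := by
    have h1 : ‖z • (1 : Matrix (Fin N) (Fin N) ℂ)‖ ≤ 1 / 8 := by
      rw [norm_smul, norm_one, mul_one]; exact hz
    have h2 := Real.log_two_gt_d9
    calc ‖z • (1 : Matrix (Fin N) (Fin N) ℂ) + mlog W‖ ≤ 1 / 8 + 1 / 2 := (norm_add_le _ _).trans (add_le_add h1 hlogW)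
      _ < Real.log 2 := by linarith
  rw [hprod, mlog_exp hsmall]

/-- ★ **CENTRAL PHASES PULL OUT OF THE PRINTED `exp[|I|⁻¹ Σ log]` AS THEIR MEAN**: for loop matrices `‖W_i − 1‖ ≤ 1∕3` and phases `‖z_i‖ ≤ 1∕8`,
`eml(e^{z_i}·W_i) = e^{|I|⁻¹Σ z_i} · eml(W)` — the U(1) part of the (0.4) correction factor is the ARITHMETIC mean of the loop phases. [cite: Balaban1987RG1, (0.4) p.253; Balaban1985Averaging, (21) p.21] -/
theorem eml_exp_smul {ι : Type*} [Fintype ι] [Nonempty ι] {z : ι → ℂ} (hz : ∀ i, ‖z i‖ ≤ 1 / 8) {W : ι → Matrix (Fin N) (Fin N) ℂ}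
    (hW : ∀ i, ‖W i - 1‖ ≤ 1 / 3) :
    eml (fun i => Complex.exp (z i) • W i) = Complex.exp (((Fintype.card ι : ℂ))⁻¹ * ∑ i, z i) • eml W := by
  rw [eml_eq_exp, eml_eq_exp]
  have hsum : ∑ i, mlog (Complex.exp (z i) • W i) = (∑ i, z i) • (1 : Matrix (Fin N) (Fin N) ℂ) + ∑ i, mlog (W i) := by
    rw [Finset.sum_smul, ← Finset.sum_add_distrib]
    exact Finset.sum_congr rfl fun i _ => mlog_exp_smul (hz i) (hW i)
  rw [hsum, smul_add, smul_smul]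
  letI : NormedAlgebra ℚ (Matrix (Fin N) (Fin N) ℂ) := NormedAlgebra.restrictScalars ℚ ℂ _
  have hcomm : Commute ((((Fintype.card ι : ℂ))⁻¹ * ∑ i, z i) • (1 : Matrix (Fin N) (Fin N) ℂ))
      ((((Fintype.card ι : ℂ))⁻¹) • ∑ i, mlog (W i)) := (Commute.one_left _).smul_left _
  rw [exp_add_of_commute hcomm, exp_smul_one_eq, smul_mul_assoc, one_mul]

variable {P : Params} {j : ℕ}

omit [NeZero N] in
/-- One oriented step of the phase-twisted field `b ↦ e^{iτθ_b}·V_b`: the phase `e^{±iτθ_b}` (conjugate on backward steps) times the step of `V`. [cite: Balaban1987RG1, (0.4) p.253 (bookkeeping)] -/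
theorem stepM_phase (θ : PBond P j → ℝ) (τ : ℝ) (V : PBond P j → Matrix (Fin N) (Fin N) ℂ) (s : LStep P j) :
    stepM (fun b => Complex.exp (((τ * θ b : ℝ) : ℂ) * Complex.I) • V b) s =
      Complex.exp (((τ * (if s.fwd then θ s.bond else -θ s.bond) : ℝ) : ℂ) * Complex.I) • stepM V s := by
  unfold stepM
  split_ifs with h
  · rfl
  · rw [star_smul, Complex.star_def, ← Complex.exp_conj, map_mul, Complex.conj_ofReal, Complex.conj_I, mul_neg,
      Complex.ofReal_mul, Complex.ofReal_mul, Complex.ofReal_neg]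
    congr 2
    ring

omit [NeZero N] in
/-- ★ **WALK PRODUCTS OF THE PHASE-TWISTED FIELD**: `holM (e^{iτθ}·V) Γ = e^{iτ·θ(Γ)} · holM V Γ` with `θ(Γ) = walkSum θ Γ` the signed sum of `θ` along `Γ` (the abelian flux).
[cite: Balaban1987RG1, (0.4) p.253; Balaban1984PropagatorsI, (1.8) p.19] -/
theorem holM_phase (θ : PBond P j → ℝ) (τ : ℝ) (V : PBond P j → Matrix (Fin N) (Fin N) ℂ) :
    ∀ γ : List (LStep P j), holM (fun b => Complex.exp (((τ * θ b : ℝ) : ℂ) * Complex.I) • V b) γ =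
      Complex.exp (((τ * walkSum θ γ : ℝ) : ℂ) * Complex.I) • holM V γ
  | [] => by simp [holM]
  | s :: γ => by
    rw [holM_cons, holM_cons, holM_phase θ τ V γ, stepM_phase, walkSum_cons, smul_mul_smul_comm, ← Complex.exp_add]
    congr 2
    push_cast
    ring


end Central

/-! ## §2  Phase equivariance of the one-step and the `k`-fold matrix average -/

section Equivariance

variable {P : Params} {j : ℕ} {N : ℕ} [NeZero N]

/-- ★★ **THE (0.4) MATRIX AVERAGE IS PHASE-EQUIVARIANT** (one step): for a fine field `V` whose loop matrices are within `1∕3` of `1` and phases with `|τ·θ(loop_i)| ≤ 1∕8`,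
`avgM (e^{iτθ}·V) c = e^{iτ·(Aθ)(c)} · avgM V c` with `(Aθ)(c) = |I|⁻¹ Σ_i θ(loop_i(c)) + θ([c₋,c₊])` — the FLAT linearised average of the real bond field `θ` ([Balaban1985Averaging] (124) on
scalars), INDEPENDENT of `V`. [cite: Balaban1987RG1, (0.4) p.253; Balaban1985Averaging, (124) p.36] -/
theorem avgM_phase (θ : PBond P j → ℝ) (V : PBond P j → Matrix (Fin N) (Fin N) ℂ)
    (hV : ∀ (c : PBond P (j + 1)) (i : Idx P), ‖loopM V c i - 1‖ ≤ 1 / 3) (τ : ℝ)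
    (hτ : ∀ (c : PBond P (j + 1)) (i : Idx P), |τ * walkSum θ (walk (emb c.src) (loopWord P.L c.dir (off i.1) i.2.1 i.2.2))| ≤ 1 / 8) (c : PBond P (j + 1)) :
    avgM (fun b => Complex.exp (((τ * θ b : ℝ) : ℂ) * Complex.I) • V b) c =
      Complex.exp (((τ * (((Fintype.card (Idx P) : ℝ))⁻¹ * ∑ i : Idx P, walkSum θ (walk (emb c.src) (loopWord P.L c.dir (off i.1) i.2.1 i.2.2)) +
        walkSum θ (walk (emb c.src) (List.replicate P.L (c.dir, true)))) : ℝ) : ℂ) * Complex.I) • avgM V c := by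
  -- the loops and the straight segment of the twisted field
  have hloop : ∀ i : Idx P, loopM (fun b => Complex.exp (((τ * θ b : ℝ) : ℂ) * Complex.I) • V b) c i =
      Complex.exp (((τ * walkSum θ (walk (emb c.src) (loopWord P.L c.dir (off i.1) i.2.1 i.2.2)) : ℝ) : ℂ) * Complex.I) • loopM V c i :=
    fun i => holM_phase θ τ V _
  have hax : axialM (fun b => Complex.exp (((τ * θ b : ℝ) : ℂ) * Complex.I) • V b) c =
      Complex.exp (((τ * walkSum θ (walk (emb c.src) (List.replicate P.L (c.dir, true))) : ℝ) : ℂ) * Complex.I) • axialM V c :=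
    holM_phase θ τ V _
  -- the correction factor: central phases pull out of `eml`
  have hcorr : corrM (fun b => Complex.exp (((τ * θ b : ℝ) : ℂ) * Complex.I) • V b) c =
      Complex.exp (((Fintype.card (Idx P) : ℂ))⁻¹ * ∑ i : Idx P, (((τ * walkSum θ (walk (emb c.src) (loopWord P.L c.dir (off i.1) i.2.1 i.2.2)) : ℝ) : ℂ) * Complex.I)) •
        corrM V c := by
    unfold corrM
    simp only [hloop]
    refine eml_exp_smul (fun i => ?_) (hV c)
    rw [norm_mul, Complex.norm_I, mul_one, Complex.norm_real, Real.norm_eq_abs]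
    exact hτ c i
  unfold avgM
  rw [hcorr, hax, smul_mul_smul_comm, ← Complex.exp_add]
  -- `corrM V c * axialM V c` is `avgM V c` definitionally; compare the exponents
  congr 2
  push_cast
  rw [mul_add, add_mul, Finset.mul_sum]
  congr 1
  rw [Finset.mul_sum, Finset.mul_sum, Finset.sum_mul]
  exact Finset.sum_congr rfl fun i _ => by ring


/-- ★★ **THE `k`-FOLD MATRIX AVERAGE IS PHASE-EQUIVARIANT NEAR `τ = 0`**: for every real fine field `θ` there is a real level-`k` field `φ` (the `k`-fold flat scalar average of `θ`) such
that for EVERY fine matrix field `V` whose iterated loop matrices below `k` are within `1∕3` of `1`, `iterM k (e^{iτθ}·V) = e^{iτφ}·iterM k V` for `τ` near `0` — the same `φ`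
at the curved background and at the flat one. [cite: Balaban1987RG1, (0.4) p.253, (0.21) p.256; Balaban1985Averaging, (124) p.36] -/
theorem iterM_phase_eventually (θ : PBond P 0 → ℝ) :
    ∀ k : ℕ, ∃ φ : PBond P k → ℝ, ∀ V : PBond P 0 → Matrix (Fin N) (Fin N) ℂ,
      (∀ j, j < k → ∀ (c : PBond P (j + 1)) (i : Idx P), ‖loopM (iterM j V) c i - 1‖ ≤ 1 / 3) →
      ∀ᶠ τ in 𝓝 (0 : ℝ), iterM k (fun b => Complex.exp (((τ * θ b : ℝ) : ℂ) * Complex.I) • V b) =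
        fun c => Complex.exp (((τ * φ c : ℝ) : ℂ) * Complex.I) • iterM k V c
  | 0 => ⟨θ, fun V _ => Eventually.of_forall fun τ => rfl⟩
  | k + 1 => by
    obtain ⟨φ, hφ⟩ := iterM_phase_eventually θ k
    refine ⟨fun c => ((Fintype.card (Idx P) : ℝ))⁻¹ * ∑ i : Idx P, walkSum φ (walk (emb c.src) (loopWord P.L c.dir (off i.1) i.2.1 i.2.2)) +
        walkSum φ (walk (emb c.src) (List.replicate P.L (c.dir, true))), fun V hV => ?_⟩
    have h1 := hφ V (fun j hj => hV j (Nat.lt_succ_of_lt hj))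
    have h2 : ∀ᶠ τ in 𝓝 (0 : ℝ), ∀ (c : PBond P (k + 1)) (i : Idx P),
        |τ * walkSum φ (walk (emb c.src) (loopWord P.L c.dir (off i.1) i.2.1 i.2.2))| ≤ 1 / 8 := by
      have hci : ∀ ci : PBond P (k + 1) × Idx P, ∀ᶠ τ in 𝓝 (0 : ℝ),
          |τ * walkSum φ (walk (emb ci.1.src) (loopWord P.L ci.1.dir (off ci.2.1) ci.2.2.1 ci.2.2.2))| ≤ 1 / 8 := by
        intro ci
        have ht : Tendsto (fun τ : ℝ => |τ * walkSum φ (walk (emb ci.1.src) (loopWord P.L ci.1.dir (off ci.2.1) ci.2.2.1 ci.2.2.2))|) (𝓝 0) (𝓝 0) := by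
          have hc := ((continuous_id.mul continuous_const).abs :
            Continuous fun τ : ℝ => |τ * walkSum φ (walk (emb ci.1.src) (loopWord P.L ci.1.dir (off ci.2.1) ci.2.2.1 ci.2.2.2))|).tendsto 0
          simpa using hc
        exact ht.eventually (eventually_le_nhds (by norm_num))
      exact (eventually_all.2 hci).mono fun τ hτ c i => hτ (c, i)
    filter_upwards [h1, h2] with τ hτ1 hτ2
    rw [iterM_succ, iterM_succ, hτ1]
    funext c
    exact avgM_phase φ (iterM k V) (hV k (Nat.lt_succ_self k)) τ hτ2 c


end Equivariance

/-! ## §3  The U(1) directions of `Q_k(U₀)` -/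

section Derivative

variable {P : Params} {N : ℕ} [NeZero N]

omit [NeZero N] in
/-- The phase curve `τ ↦ e^{iτr}·M` has velocity `(ir)·M` at `τ = 0`. [folklore] -/
theorem hasDerivAt_phase_smul (r : ℝ) (M : Matrix (Fin N) (Fin N) ℂ) :
    HasDerivAt (fun τ : ℝ => Complex.exp (((τ * r : ℝ) : ℂ) * Complex.I) • M) ((((r : ℝ) : ℂ) * Complex.I) • M) 0 := by
  have h1 : HasDerivAt (fun τ : ℝ => (τ : ℂ) * (((r : ℝ) : ℂ) * Complex.I)) (1 * (((r : ℝ) : ℂ) * Complex.I)) 0 :=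
    (Complex.ofRealCLM.hasDerivAt).mul_const _
  have h2 := h1.cexp
  simp only [Complex.ofReal_zero, zero_mul, Complex.exp_zero, one_mul] at h2
  have h3 := h2.smul_const M
  refine h3.congr_of_eventuallyEq (Eventually.of_forall fun τ => ?_)
  show Complex.exp (((τ * r : ℝ) : ℂ) * Complex.I) • M = Complex.exp ((τ : ℂ) * ((r : ℂ) * Complex.I)) • M
  push_cast
  rw [mul_assoc]

omit [NeZero N] in
/-- **DERIVATIVE TRANSFER**: if `iterM k` has Fréchet derivative `D` at `V` and `iterM k (e^{iτθ}·V) = e^{iτφ}·iterM k V` for `τ` near `0`, then `D(iθ·V) = iφ·iterM k V` (chain rule along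
the phase curve + uniqueness of the derivative). [cite: Balaban1985Variational, (44) p.285 (bookkeeping)] -/
theorem fderiv_phase_of_eventually {k : ℕ} {V : PBond P 0 → Matrix (Fin N) (Fin N) ℂ}
    {D : (PBond P 0 → Matrix (Fin N) (Fin N) ℂ) →L[ℝ] (PBond P k → Matrix (Fin N) (Fin N) ℂ)}
    (hD : HasFDerivAt (iterM k : (PBond P 0 → Matrix (Fin N) (Fin N) ℂ) → PBond P k → Matrix (Fin N) (Fin N) ℂ) D V)
    {θ : PBond P 0 → ℝ} {φ : PBond P k → ℝ}
    (heq : ∀ᶠ τ in 𝓝 (0 : ℝ), iterM k (fun b => Complex.exp (((τ * θ b : ℝ) : ℂ) * Complex.I) • V b) =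
        fun c => Complex.exp (((τ * φ c : ℝ) : ℂ) * Complex.I) • iterM k V c) :
    D (fun b => ((((θ b : ℝ) : ℂ) * Complex.I)) • V b) = fun c => ((((φ c : ℝ) : ℂ) * Complex.I)) • iterM k V c := by
  -- the fine phase curve and its velocity
  have hγ : HasDerivAt (fun τ : ℝ => fun b => Complex.exp (((τ * θ b : ℝ) : ℂ) * Complex.I) • V b)
      (fun b => ((((θ b : ℝ) : ℂ) * Complex.I)) • V b) 0 :=
    hasDerivAt_pi.2 fun b => hasDerivAt_phase_smul (θ b) (V b)
  have hγ0 : (fun b => Complex.exp ((((0 : ℝ) * θ b : ℝ) : ℂ) * Complex.I) • V b) = V := by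
    funext b; simp
  have hD' : HasFDerivAt (iterM k : (PBond P 0 → Matrix (Fin N) (Fin N) ℂ) → PBond P k → Matrix (Fin N) (Fin N) ℂ) D
      ((fun τ : ℝ => fun b => Complex.exp (((τ * θ b : ℝ) : ℂ) * Complex.I) • V b) 0) := by
    have hpt : ((fun τ : ℝ => fun b => Complex.exp (((τ * θ b : ℝ) : ℂ) * Complex.I) • V b) 0) = V := hγ0
    rw [hpt]; exact hD
  have hcomp := hD'.comp_hasDerivAt (0 : ℝ) hγ
  -- the coarse phase curve and its velocity
  have hδ : HasDerivAt (fun τ : ℝ => fun c => Complex.exp (((τ * φ c : ℝ) : ℂ) * Complex.I) • iterM k V c)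
      (fun c => ((((φ c : ℝ) : ℂ) * Complex.I)) • iterM k V c) 0 :=
    hasDerivAt_pi.2 fun c => hasDerivAt_phase_smul (φ c) (iterM k V c)
  have hδ' : HasDerivAt ((iterM k : (PBond P 0 → Matrix (Fin N) (Fin N) ℂ) → PBond P k → Matrix (Fin N) (Fin N) ℂ) ∘
      (fun τ : ℝ => fun b => Complex.exp (((τ * θ b : ℝ) : ℂ) * Complex.I) • V b))
      (fun c => ((((φ c : ℝ) : ℂ) * Complex.I)) • iterM k V c) 0 :=
    hδ.congr_of_eventuallyEq (heq.mono fun τ hτ => by simp only [Function.comp_apply]; exact hτ)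
  exact hcomp.unique hδ'

/-- ★★★ **THE U(1) DIRECTIONS OF `Q_k(U₀)` AT A GUARDED BACKGROUND ARE THE FLAT ONES, RIGHT-MULTIPLIED BY `Ū^k(U₀)`**: under 35b's guard `SmallBelow` at `U₀` (every member of
the small-field class), for every real fine field `θ`: `dIterL k ↑U₀ (b ↦ (iθ_b)·↑U₀ b) = (c ↦ (dIterL k 1 (iθ·1))(c) · ↑Ū^k(U₀)(c))` — the phase part of print's `Q_k(U₀)` does not see
the background (§2's equivariance at `V := ↑U₀` and at `V := 1` with the SAME exponent field, n07-w1's `hasFDerivAt_iterM` ∕ `hasFDerivAt_iterM_one`).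
[cite: Balaban1985Variational, (18) p.281, (44) p.285; Balaban1985BackgroundPropagators, (3.13)–(3.15) p.393; Balaban1987RG1, (0.4) p.253, (0.21) p.256] -/
theorem dIterL_phase_eq_flat_mul {k : ℕ} {U₀ : GaugeField P 0 (SU N)}
    (hSB : SmallBelow (fun j => blockAvg (P := P) (j := j) (expMeanLogSU (n := Fin N))) k U₀) (θ : PBond P 0 → ℝ) :
    dIterL k (coeField U₀) (fun b => ((((θ b : ℝ) : ℂ) * Complex.I)) • (U₀ b : Matrix (Fin N) (Fin N) ℂ)) =
      fun c => dIterL k (1 : PBond P 0 → Matrix (Fin N) (Fin N) ℂ) (fun b => ((((θ b : ℝ) : ℂ) * Complex.I)) • (1 : Matrix (Fin N) (Fin N) ℂ)) c *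
        ((Averaging.iter (fun j => blockAvg (P := P) (j := j) (expMeanLogSU (n := Fin N))) k U₀ c : SU N) : Matrix (Fin N) (Fin N) ℂ) := by
  obtain ⟨φ, hφ⟩ := iterM_phase_eventually (P := P) (N := N) θ k
  -- the guard at the curved background and at the flat one
  have hgU : ∀ j, j < k → ∀ (c : PBond P (j + 1)) (i : Idx P), ‖loopM (iterM j (coeField U₀)) c i - 1‖ ≤ 1 / 3 := by
    intro j hj c i
    rw [← coeField_iter_eq_iterM j (hSB.mono hj.le)]
    exact (lt_third_of_lt_deltaSU (norm_loopM_coeField_sub_one_lt _ c (hSB j hj c) i)).le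
  have hg1 : ∀ j, j < k → ∀ (c : PBond P (j + 1)) (i : Idx P), ‖loopM (iterM j (1 : PBond P 0 → Matrix (Fin N) (Fin N) ℂ)) c i - 1‖ ≤ 1 / 3 := by
    intro j _ c i
    rw [iterM_apply_one]
    simp [loopM]
  have hU := fderiv_phase_of_eventually (hasFDerivAt_iterM k hSB) (hφ (coeField U₀) hgU)
  have h1 := fderiv_phase_of_eventually (hasFDerivAt_iterM_one (P := P) (N := N) k) (hφ 1 hg1)
  simp only [Pi.one_apply, iterM_apply_one] at h1
  show dIterL k (coeField U₀) (fun b => ((((θ b : ℝ) : ℂ) * Complex.I)) • coeField U₀ b) = _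
  rw [hU]
  funext c
  rw [h1]
  dsimp only
  rw [smul_mul_assoc, one_mul, ← coeField_iter_eq_iterM k hSB, coeField_apply]


end Derivative

/-! ## §4  The flat scalar line is onto -/

section FlatScalar

variable {P : Params} {j : ℕ} {N : ℕ} [NeZero N]

/-- **ONE STEP OF THE FLAT SCALAR LINE IS ONTO**: for `j + 1 ≤ m + K` every imaginary-scalar coarse field `iψ·1` is `linAvg` of an imaginary-scalar fine field `iθ·1` (UST's right
inverse `Prop7LinAvgOnto.linAvg_surjective` read through the real-linear projection `X ↦ (i·Im tr X ∕ N)·1`, which commutes with `linAvg` —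
`K0Stub1RecordAveragingRightInverse.linAvg_realLinear`). [cite: Balaban1985Variational, (45) p.285; Balaban1985Averaging, (124)–(125) p.36] -/
theorem exists_phase_linAvg_eq (hj : j + 1 ≤ P.m + P.K) (ψ : PBond P (j + 1) → ℝ) :
    ∃ θ : PBond P j → ℝ, (fun c => linAvg (fun b => ((((θ b : ℝ) : ℂ) * Complex.I)) • (1 : Matrix (Fin N) (Fin N) ℂ)) c) =
      fun c => ((((ψ c : ℝ) : ℂ) * Complex.I)) • (1 : Matrix (Fin N) (Fin N) ℂ) := by
  classical
  obtain ⟨Y, hY⟩ := Summit.QuantumFields.YangMills.Theorems.Prop7LinAvgOnto.linAvg_surjective (n := Fin N) hj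
    (fun c => ((((ψ c : ℝ) : ℂ) * Complex.I)) • (1 : Matrix (Fin N) (Fin N) ℂ))
  -- the real-linear projection onto the imaginary scalar line
  let π : Matrix (Fin N) (Fin N) ℂ →ₗ[ℝ] Matrix (Fin N) (Fin N) ℂ :=
    { toFun := fun X => (((((Matrix.trace X).im / N : ℝ)) : ℂ) * Complex.I) • (1 : Matrix (Fin N) (Fin N) ℂ)
      map_add' := fun X X' => by
        rw [Matrix.trace_add, Complex.add_im, add_div, ← add_smul]
        push_cast
        ring_nf
      map_smul' := fun r X => by
        rw [Matrix.trace_smul, RingHom.id_apply, Complex.smul_im, smul_eq_mul, mul_div_assoc, ← Complex.coe_smul, smul_smul]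
        push_cast
        ring_nf }
  have hπ : ∀ r : ℝ, π (((((r : ℝ) : ℂ) * Complex.I)) • (1 : Matrix (Fin N) (Fin N) ℂ)) = ((((r : ℝ) : ℂ) * Complex.I)) • (1 : Matrix (Fin N) (Fin N) ℂ) := by
    intro r
    have hN : (N : ℝ) ≠ 0 := Nat.cast_ne_zero.2 (NeZero.ne N)
    show (((((Matrix.trace (((((r : ℝ) : ℂ) * Complex.I)) • (1 : Matrix (Fin N) (Fin N) ℂ))).im / N : ℝ)) : ℂ) * Complex.I) • (1 : Matrix (Fin N) (Fin N) ℂ) = _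
    rw [Matrix.trace_smul, Matrix.trace_one, Fintype.card_fin, smul_eq_mul]
    congr 2
    have : ((((r : ℝ) : ℂ) * Complex.I) * (N : ℂ)).im = r * N := by simp
    rw [this, mul_div_assoc, div_self hN, mul_one]
  refine ⟨fun b => (Matrix.trace (Y b)).im / N, ?_⟩
  funext c
  have h := Summit.QuantumFields.YangMills.Theorems.K0Stub1RecordAveragingRightInverse.linAvg_realLinear π Y c
  have hYc : linAvg Y c = ((((ψ c : ℝ) : ℂ) * Complex.I)) • (1 : Matrix (Fin N) (Fin N) ℂ) := congrFun hY c
  rw [hYc, hπ] at h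
  exact h

omit [NeZero N] in
/-- The imaginary-scalar matrix `(ir)·1` is skew-Hermitian. [folklore] -/
theorem star_phase_smul_one (r : ℝ) : star (((((r : ℝ) : ℂ) * Complex.I)) • (1 : Matrix (Fin N) (Fin N) ℂ)) = -(((((r : ℝ) : ℂ) * Complex.I)) • (1 : Matrix (Fin N) (Fin N) ℂ)) := by
  rw [star_smul, star_one, Complex.star_def, map_mul, Complex.conj_ofReal, Complex.conj_I, mul_neg, neg_smul]

/-- ★★ **THE FLAT SCALAR LINE OF `Q_k(1)` IS ONTO** (`k ≤ m + K`): every imaginary-scalar level-`k` field `iψ·1` is `dIterL k 1` of an imaginary-scalar fine field `iθ·1` (induction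
along n07-w1's flat chain rule `dIterL_one_succ` and `dAvgL_one_apply_of_skew`). [cite: Balaban1985Variational, (44)–(45) p.285; Balaban1985Averaging, (124)–(125) p.36] -/
theorem exists_phase_dIterL_one_eq : ∀ k : ℕ, k ≤ P.m + P.K → ∀ ψ : PBond P k → ℝ,
    ∃ θ : PBond P 0 → ℝ, dIterL k (1 : PBond P 0 → Matrix (Fin N) (Fin N) ℂ) (fun b => ((((θ b : ℝ) : ℂ) * Complex.I)) • (1 : Matrix (Fin N) (Fin N) ℂ)) =
      fun c => ((((ψ c : ℝ) : ℂ) * Complex.I)) • (1 : Matrix (Fin N) (Fin N) ℂ)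
  | 0, _, ψ => ⟨ψ, by rw [dIterL_zero, ContinuousLinearMap.id_apply]⟩
  | k + 1, hk, ψ => by
    obtain ⟨ψ', hψ'⟩ := exists_phase_linAvg_eq (N := N) hk ψ
    obtain ⟨θ, hθ⟩ := exists_phase_dIterL_one_eq k (Nat.le_of_succ_le hk) ψ'
    refine ⟨θ, ?_⟩
    rw [dIterL_one_succ, ContinuousLinearMap.comp_apply, hθ, ← hψ']
    funext c
    exact dAvgL_one_apply_of_skew (fun b => star_phase_smul_one (ψ' b)) c


end FlatScalar

end Summit.QuantumFields.YangMills.BalabanUVNodes.N07AveragingPhaseEquivariance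

end
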